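import Summits.ValiantsHypothesis.ValiantsHypothesis.Theorems.SymPencilSymmetrizePermPairsSmallIndexPairs
import HarnessLib

/-!
# ValiantsHypothesis / SymPencil — crux `SymmetrizePermPairs` (stmt-ValiantsHypothesis-17793), line
# `birth_SymmetrizePermPairs`, stub `stub_induce`, small-index regime: the SYMMETRIC CORE
# `𝔖_{a₁} × 𝔖_{a₂} ↪ Alt(Ω∖X₁) × Alt(Ω∖X₂)` (signed embeddings)

Helper of the item (`--supports stmt-ValiantsHypothesis-17793 --as helper`; 0 definitions, 0 named
facts).  In the small-index regime of `stub_induce` (cut of record, merged desk RULING #167; p6's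
(G1)–(G5) give `Alt(Ω∖X₁) × Alt(Ω∖X₂) ≤ φ(G)`), the spin dichotomy is available at the
`𝔖 × 𝔖` level only (`SpinDichotomy.spinDichotomy_two_degree`, p602697: it needs a surjection onto
`𝔖_{a₁} × 𝔖_{a₂}`).  This file supplies the group theory that makes the `𝔖`-level statement
sufficient: the **signed embedding** `𝔖_a ↪ 𝔄_{a+2}`, `σ ↦ σ · (p q)^{[sgn σ = −1]}` on two
spare points `p, q`, realised inside `Perm (Fin n)`:

* `exists_signedPerm` — for `X ⊆ Fin n` with `|X| + 2 ≤ n` there is an injective homomorphism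
  `s : Perm (Fin a) →* Perm (Fin n)`, `a = n − |X| − 2`, with image in `Alt(Fin n ∖ X)` (p6's
  `(alternatingGroup {x // x ∉ X}).map Perm.ofSubtype`, membership `mem_altFixing_iff`);
* **`exists_symmetric_core`** — for `X₁, X₂` the product embedding
  `j : Perm (Fin a₁) × Perm (Fin a₂) →* Perm (Fin n) × Perm (Fin n)` is injective, lands in
  `Alt(∖X₁) × Alt(∖X₂)`, and has `[𝔖_n × 𝔖_n : j.range] ≤ n^{|X₁| + |X₂| + 4}`.

So a lift group over `H ⊇ Alt(∖X₁) × Alt(∖X₂)` restricts, at polynomial index cost, to a group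
SURJECTING onto `𝔖_{a₁} × 𝔖_{a₂}` with the same scalar kernel — where `spinDichotomy_two_degree`
applies.  Honest framing: group-theoretic plumbing; `stub_induce`, the crux
`SymPencil.SymmetrizePermPairs` and `VP ≠ VNP` remain OPEN and nothing here is progress on them.
-/

noncomputable section

set_option linter.dupNamespace false

namespace Summit.ValiantsHypothesis.ValiantsHypothesis.Theorems.SymPencilEquivariantSdcNotQP.SmallIndex

open Equiv Equiv.Perm

/-- **The signed embedding `𝔖_a ↪ Alt(Fin n ∖ X)`**, `a = n − |X| − 2`: permutations of the
points outside `X ∪ {p, q}` (two spare points), corrected by the transposition `(p q)` when odd,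
form a copy of `𝔖_a` made of EVEN permutations fixing `X` pointwise. [folklore] -/
theorem exists_signedPerm {n : ℕ} (X : Finset (Fin n)) (hX : X.card + 2 ≤ n) :
    ∃ (a : ℕ) (s : Perm (Fin a) →* Perm (Fin n)),
      a = n - X.card - 2 ∧ Function.Injective s ∧
      s.range ≤ (alternatingGroup {x // x ∉ X}).map
        (Equiv.Perm.ofSubtype : Perm {x // x ∉ X} →* Perm (Fin n)) := by
  classical
  -- two spare points outside `X`
  have hc : 1 < (Xᶜ).card := by rw [Finset.card_compl, Fintype.card_fin]; omega
  obtain ⟨p, hp, q, hq, hpq⟩ := Finset.one_lt_card.mp hc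
  rw [Finset.mem_compl] at hp hq
  set Y : Finset (Fin n) := insert p (insert q X) with hY
  have hYcard : Y.card = X.card + 2 := by
    rw [hY, Finset.card_insert_of_notMem (by simp [hpq, hp]), Finset.card_insert_of_notMem hq]
  have hpY : p ∈ Y := by simp [hY]
  have hqY : q ∈ Y := by simp [hY]
  have hXY : ∀ x ∈ X, x ∈ Y := fun x hx => by simp [hY, hx]
  -- the free points and their enumeration
  set a := Fintype.card {x // x ∉ Y} with ha
  have hacard : a = n - X.card - 2 := by
    rw [ha, Fintype.card_subtype_compl, Fintype.card_fin, Fintype.card_coe, hYcard]; omega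
  let e : Fin a ≃ {x // x ∉ Y} := (Fintype.equivFin {x // x ∉ Y}).symm
  let base : Perm (Fin a) →* Perm (Fin n) :=
    (Equiv.Perm.ofSubtype : Perm {x // x ∉ Y} →* Perm (Fin n)).comp e.permCongrHom.toMonoidHom
  have hbase : ∀ σ, base σ = Equiv.Perm.ofSubtype (e.permCongr σ) := fun σ => rfl
  have hbase_fix : ∀ σ, ∀ x ∈ Y, base σ x = x := fun σ x hx => by
    rw [hbase]; exact Equiv.Perm.ofSubtype_apply_of_not_mem _ (fun h => h hx)
  have hbase_sign : ∀ σ, sign (base σ) = sign σ := fun σ => by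
    rw [hbase, sign_ofSubtype, sign_permCongr]
  have hbase_inj : Function.Injective base := fun σ τ h =>
    e.permCongr.injective (Equiv.Perm.ofSubtype_injective h)
  -- the sign-compensating factor `(p q)^{[sgn σ = -1]}`
  let t : Perm (Fin a) → Perm (Fin n) := fun σ => if sign σ = 1 then 1 else swap p q
  have ht_mul : ∀ σ τ, t (σ * τ) = t σ * t τ := by
    intro σ τ
    simp only [t, map_mul]
    rcases Int.units_eq_one_or (sign σ) with h1 | h1 <;>
      rcases Int.units_eq_one_or (sign τ) with h2 | h2 <;>
      simp [h1, h2, swap_mul_self]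
  have ht_sign : ∀ σ, sign (t σ) = sign σ := by
    intro σ
    simp only [t]
    rcases Int.units_eq_one_or (sign σ) with h1 | h1
    · simp [h1]
    · simp [h1, sign_swap hpq]
  have ht_fix : ∀ σ x, x ≠ p → x ≠ q → t σ x = x := by
    intro σ x hxp hxq
    simp only [t]
    split_ifs
    · rfl
    · rw [swap_apply_of_ne_of_ne hxp hxq]
  have ht_p : ∀ σ, t σ = 1 ∨ t σ p = q := by
    intro σ
    simp only [t]
    split_ifs
    · exact Or.inl rfl
    · exact Or.inr (swap_apply_left p q)
  -- `base τ` and `t σ` have disjoint supports, hence commute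
  have hcomm : ∀ σ τ, Commute (base τ) (t σ) := by
    intro σ τ
    refine Equiv.Perm.Disjoint.commute fun x => ?_
    by_cases hx : x ∈ Y
    · exact Or.inl (hbase_fix τ x hx)
    · refine Or.inr (ht_fix σ x ?_ ?_) <;> rintro rfl
      · exact hx hpY
      · exact hx hqY
  -- the signed embedding
  let s : Perm (Fin a) →* Perm (Fin n) :=
    { toFun := fun σ => base σ * t σ
      map_one' := by simp [t]
      map_mul' := fun σ τ => by
        rw [map_mul, ht_mul, mul_assoc, ← mul_assoc (base τ), (hcomm σ τ).eq]
        simp only [mul_assoc] }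
  have hs : ∀ σ, s σ = base σ * t σ := fun σ => rfl
  refine ⟨a, s, hacard, ?_, ?_⟩
  · -- injective
    rw [injective_iff_map_eq_one]
    intro σ hσ
    rw [hs] at hσ
    rcases ht_p σ with h1 | h1
    · rw [h1, mul_one] at hσ
      exact hbase_inj (by rw [hσ, map_one])
    · exfalso
      have := congrArg (fun f : Perm (Fin n) => f p) hσ
      simp only [Perm.coe_mul, Function.comp_apply, h1, Perm.coe_one, id_eq] at this
      rw [hbase_fix σ q hqY] at this
      exact hpq this.symm
  · -- image in `Alt(Fin n ∖ X)`
    rintro _ ⟨σ, rfl⟩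
    rw [mem_altFixing_iff, hs]
    refine ⟨fun x hx => ?_, ?_⟩
    · rw [Perm.coe_mul, Function.comp_apply,
        ht_fix σ x (by rintro rfl; exact hp hx) (by rintro rfl; exact hq hx), hbase_fix σ x (hXY x hx)]
    · rw [map_mul, hbase_sign, ht_sign]
      rcases Int.units_eq_one_or (sign σ) with h1 | h1 <;> simp [h1]

/-- **The symmetric core of the small-index regime.**  For `X₁, X₂ ⊆ Fin n` with `|X_i| + 2 ≤ n`
there are `a_i = n − |X_i| − 2` and an injective homomorphism
`j : 𝔖_{a₁} × 𝔖_{a₂} →* 𝔖_n × 𝔖_n` with image inside `Alt(∖X₁) × Alt(∖X₂)` and of index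
`[𝔖_n × 𝔖_n : j(𝔖_{a₁} × 𝔖_{a₂})] ≤ n^{|X₁| + |X₂| + 4}`. [folklore] -/
theorem exists_symmetric_core {n : ℕ} (X₁ X₂ : Finset (Fin n)) (h₁ : X₁.card + 2 ≤ n)
    (h₂ : X₂.card + 2 ≤ n) :
    ∃ (a₁ a₂ : ℕ) (j : Perm (Fin a₁) × Perm (Fin a₂) →* Perm (Fin n) × Perm (Fin n)),
      a₁ = n - X₁.card - 2 ∧ a₂ = n - X₂.card - 2 ∧ Function.Injective j ∧
      j.range ≤ ((alternatingGroup {x // x ∉ X₁}).map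
          (Equiv.Perm.ofSubtype : Perm {x // x ∉ X₁} →* Perm (Fin n))).prod
        ((alternatingGroup {x // x ∉ X₂}).map
          (Equiv.Perm.ofSubtype : Perm {x // x ∉ X₂} →* Perm (Fin n))) ∧
      j.range.index ≤ n ^ (X₁.card + X₂.card + 4) := by
  classical
  obtain ⟨a₁, s₁, ha₁, hs₁, hr₁⟩ := exists_signedPerm X₁ h₁
  obtain ⟨a₂, s₂, ha₂, hs₂, hr₂⟩ := exists_signedPerm X₂ h₂
  refine ⟨a₁, a₂, s₁.prodMap s₂, ha₁, ha₂, fun x y h => ?_, ?_, ?_⟩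
  · exact Prod.ext (hs₁ (congrArg Prod.fst h)) (hs₂ (congrArg Prod.snd h))
  · rintro _ ⟨x, rfl⟩
    exact Subgroup.mem_prod.2 ⟨hr₁ ⟨x.1, rfl⟩, hr₂ ⟨x.2, rfl⟩⟩
  · -- index count: `[ : j.range] · a₁! a₂! = n! n!` and `n!/aᵢ! = n(n-1)⋯(aᵢ+1) ≤ n^{|Xᵢ|+2}`
    set J := (s₁.prodMap s₂).range with hJ
    have hinj : Function.Injective (s₁.prodMap s₂) := fun x y h =>
      Prod.ext (hs₁ (congrArg Prod.fst h)) (hs₂ (congrArg Prod.snd h))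
    have hcardJ : Nat.card J = a₁.factorial * a₂.factorial := by
      rw [hJ, ← Nat.card_congr (MonoidHom.ofInjective hinj).toEquiv, Nat.card_prod, Nat.card_perm,
        Nat.card_perm, Nat.card_eq_fintype_card, Fintype.card_fin, Nat.card_eq_fintype_card,
        Fintype.card_fin]
    have hmul : J.index * (a₁.factorial * a₂.factorial) = n.factorial * n.factorial := by
      rw [← hcardJ, Subgroup.index_mul_card, Nat.card_prod, Nat.card_perm, Nat.card_eq_fintype_card,
        Fintype.card_fin]
    have hd₁ : n.factorial = a₁.factorial * n.descFactorial (X₁.card + 2) := by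
      rw [ha₁, show n - X₁.card - 2 = n - (X₁.card + 2) by omega]
      exact (Nat.factorial_mul_descFactorial h₁).symm
    have hd₂ : n.factorial = a₂.factorial * n.descFactorial (X₂.card + 2) := by
      rw [ha₂, show n - X₂.card - 2 = n - (X₂.card + 2) by omega]
      exact (Nat.factorial_mul_descFactorial h₂).symm
    have hpos : 0 < a₁.factorial * a₂.factorial :=
      Nat.mul_pos (Nat.factorial_pos _) (Nat.factorial_pos _)
    have hidx : J.index = n.descFactorial (X₁.card + 2) * n.descFactorial (X₂.card + 2) := by
      apply Nat.eq_of_mul_eq_mul_right hpos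
      calc J.index * (a₁.factorial * a₂.factorial) = n.factorial * n.factorial := hmul
        _ = a₁.factorial * n.descFactorial (X₁.card + 2) *
              (a₂.factorial * n.descFactorial (X₂.card + 2)) := by rw [← hd₁, ← hd₂]
        _ = n.descFactorial (X₁.card + 2) * n.descFactorial (X₂.card + 2) *
              (a₁.factorial * a₂.factorial) := by ring
    rw [hidx, show X₁.card + X₂.card + 4 = (X₁.card + 2) + (X₂.card + 2) by omega, pow_add]
    exact Nat.mul_le_mul (Nat.descFactorial_le_pow _ _) (Nat.descFactorial_le_pow _ _)

end Summit.ValiantsHypothesis.ValiantsHypothesis.Theorems.SymPencilEquivariantSdcNotQP.SmallIndex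

end
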